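import Summits.NavierStokesRegularity.NavierStokesRegularity.Theses.SlicedKelvin
import Summits.NavierStokesRegularity.NavierStokesRegularity.Theorems.SlicedKelvinPlanarFluxAPrioriOfSlabApexBound
import HarnessLib

/-!
# Route SlicedKelvin — support item `SlabApexBoundSuffices` PROVED (stmt-NavierStokesRegularity-18238)

`SlabApexBound → PlanarFluxAPriori`: `SlabApexBound` unfolds (by `delta`) to the hypothesis of the
landed `SlicedKelvinPlanarFluxAPriori.planarFluxAPriori_of_slabApexBound` (the crux reduced to the
one open stub of line `Sketch`, rev 4), whose conclusion is `PlanarFluxAPriori` by name. One-line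
closure, as announced in the route file (repair planner's Glue.lean).

HONEST FRAMING: pure logic over a landed reduction; `SlabApexBound` itself stays OPEN; nothing here
bears on the regularity question. Lands `--workitem stmt-NavierStokesRegularity-18238` (typer seat g19
of cell pub-ns-dss, idle-row item).
-/

namespace Summit.NavierStokesRegularity.NavierStokesRegularity.Theorems

set_option linter.dupNamespace false

/-- **`SlabApexBoundSuffices` (stmt-NavierStokesRegularity-18238)**: the slab apex bound implies the
planar flux a-priori bound, by `planarFluxAPriori_of_slabApexBound`. [this file] -/
theorem slicedKelvin_slabApexBoundSuffices_proof : Theses.SlicedKelvin.SlabApexBoundSuffices :=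
  fun h => SlicedKelvinPlanarFluxAPriori.planarFluxAPriori_of_slabApexBound h

end Summit.NavierStokesRegularity.NavierStokesRegularity.Theorems
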